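import Literature.MathematicalPhysics.QuantumFieldTheory.Balaban1983to89.B3Ineq210ZeroTorus
import Literature.MathematicalPhysics.QuantumFieldTheory.Balaban1983to89.B4Lemma24TorusScales

/-!
# `Balaban1983to89.B3Ineq211ZeroTorus` — T. Bałaban, *(Higgs)₂,₃ quantum fields in a finite volume. III. Renormalization*,
# Commun. Math. Phys. **88** (1983) 411–445 [Balaban1983Higgs3]: the Hölder-norm bound (2.11) p. 426 of the scale pieces,
# `|x₂−x₁|^{−α}|U(B̃(Γ_{x₁,x₂}))(D^η_{B̃,μ}G^η_{(j)})(Ω,B̃;x₂,x) − (D^η_{B̃,μ}G^η_{(j)})(Ω,B̃;x₁,x)| ≤ O(1)(L^jη)^{−d+1−α}e^{−δ₁(L^jη)^{−1}dist({x₁,x₂},x)}`,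
# PROVED for the TORUS MODEL INSTANCE `A = B̃ = 0`, `Ω = T_η` at every fixed Hölder exponent `0 ≤ α < 1`:
# `ScaledKernels.Ineq211At α δ₁ C` (the decl of record of row B3.Eq2.11) DISCHARGED for the concrete carrier `zeroTorusKernelsH`

statement-level skeleton of published theorems with citation tags; proofs where landed; nothing here is a claim about the Yang–Mills mass gap

PDF held: `paper:balaban1983-higgs-2-3-quantum-fields-finite-volume` (journal page = PDF page + 410); p. 426 [PDF 16] (2.10)–(2.11)
read in the OCR text (`p0016.txt`) and on the render `run/shared/lean/pub/pub-balaban/b2b-balaban-ref1/pages/1983-cmp88-higgs23-III/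
1983-cmp88-higgs23-III-p016-x2.png`; [B4] = T. Bałaban, *Regularity and decay of lattice Green's functions*, CMP **89** (1983)
[Balaban1983RegularityDecay], Lemma 2.4 (2.35)–(2.36) p. 582 and p. 572 (torus) as quoted by `B4Lemma24TorusHolder`.

CITATION HEADER (lean-in-tree rule).  Part of the lit-balaban TYPED SKELETON (HOME `run/shared/lean/pub/lit-balaban/`), Phase 2:
SKELETON row **B3.Eq2.11** (`HOME/lit-balaban-r15/ROWS-B3.md`, fold owner r15; DECL OF RECORD
`B3Sect2StatementsPart2.ScaledKernels.Ineq211At (α δ₁ C)`, r15 p255002, over the ABSTRACT carrier `ScaledKernels`).  TORUS TWIN of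
this seat's `B3Ineq211ZeroBox` (p254934/p255289: the same row for Neumann boxes `Ω = □`); a thin assembly over this seat's
`B3Ineq210ZeroTorus` (p258063: the torus pieces `pieceT`, `deriv_term_apply`, the derivative clause `abs_derivPieceT_le_of`, the
carrier `zeroTorusKernels`), p38 g4's `B4Lemma24TorusScales.holder236_torus` ([B4] Lemma 2.4 (2.36) ON THE TORUS, hypothesis-free,
rate chosen before `α`) and `B4Thm110ZeroTorus` (`conv_bound`, `QkGrs_apply`, `kerBounds_torus`, `T_proj_le_dXU_add_one`), p39 g5's
`B3GkZeroTorusPointwise.exp_block_le`; nothing of these is re-proved.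

WHAT IS PRINTED (B3 p. 426): *"This applies also to Hölder norms, e.g. we have
(1/|x₂−x₁|^α)|U(B̃(Γ_{x₁,x₂}))(D^η_{B̃,μ}G^η_{(j)})(Ω,B̃;x₂,x) − (D^η_{B̃,μ}G^η_{(j)})(Ω,B̃;x₁,x)| ≤ O(1)(L^jη)^{−d+1−α}e^{−δ₁(L^jη)^{−1}dist({x₁,x₂},x)},
0 ≤ α < 1. (2.11) … They all are obtained by rescaling from the η-lattice to the L^{−j}-lattice and application of Propositions
I.2.1 and I.2.3."*

WHAT IS REPRODUCED (kind «model-instance», G.1 of `HOME/PHASE2-TARGETS.md`).  On Bałaban's CONCRETE scalar torus tower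
`B1RG242Torus.tower P a msq` (volume `P = (d, L, m, K)`, finest torus `T^{(0)} = Site P 0`, `η = ε = L^{−K}`, `U ≡ 1`), for the pieces
`pieceT P a msq k j` of (2.6) (`B3Ineq210ZeroTorus`):
* §1 kernel identities (the scale factors, the weight `|x₁−x₂|^{−α} = (L^jη)^{−α}(L^j/|x₁−x₂|_T)^α`, `1 ≤ |x₁ − x₂|_T` for
  `x₁ ≠ x₂`) and `deriv_term_sub_apply` (the DIFFERENCE of two rows of `∂^η_μ term_j` = `a_j²(L^jε)Σ_{y,y′}[K1_j(μ;x₂,y) −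
  K1_j(μ;x₁,y)]C^{(j)}(y,y′)(Q_jG_j^{resc})(y′,x)`);
* §2 at one volume under the kernel inputs: **`holderFar_le_of`** (pairs `|x₁−x₂|_T ≥ L^j`, every `j`: the triangle inequality
  and the derivative clause of (2.10), weight `≤ (L^jη)^{−α}`) and **`holderNear_le_of`** (pairs `|x₁−x₂|_T ≤ L^j`, `j ≥ 1`: the
  (2.36) Hölder input in block form convolved with (2.37) and (2.35) — `row_entry_bound`, the row version of
  `B3GkZeroTorusPointwise.term_entry_bound`);
* §3 the block form of the torus (2.36) input (`near_block_form`: `min(d_{XU}(x₁,y), d_{XU}(x₂,y)) ≥ |proj x₁ − y|_{T^{(j)}} − 2` for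
  near pairs) and the monotonicity of `KerBounds` in its constants;
* §4 the CARRIER `zeroTorusKernelsH P a msq k : ScaledKernels` (= `zeroTorusKernels` with `holderDiff j μ x₁ x₂ x =
  η^{−d}|(∂^η_μ piece_j)(x₂,x) − (∂^η_μ piece_j)(x₁,x)|` and `dist2 x₁ x₂ x = η·min(|x₁−x|_T, |x₂−x|_T)`), `ineq210_iff_H` (its (2.10)
  is `zeroTorusKernels`'), and **`ineq211At_zeroTorusH`**: for `d ≥ 1`, odd `L > 1`, `a > 0`, `m² ≥ 0` and every `0 ≤ α < 1`,
  `∃ δ₁ C > 0` (functions of `d, L, a, m², α`) such that for EVERY volume with these `d, L` and every scale `1 ≤ k ≤ K`,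
  `(zeroTorusKernelsH P a msq k).Ineq211At α δ₁ C`; `ineq210_and_211At_zeroTorusH` (both (2.10) and (2.11) on the same carrier);
  §5 a witness volume.

HONEST SCOPE / DECLARED DIVERGENCES (F7).  (i) `A = B̃ = 0` (`U ≡ 1`: the parallel transport `U(B̃(Γ_{x₁,x₂})) = 1`), `Ω = T_η` the
WHOLE torus (not subsets, not `δG_k`), the scope of `B4Thm110ZeroTorus`/`B4Lemma24TorusScales`; torus sides `2L^{m+K}`, odd `L`.
(ii) `|x₁ − x₂|` = `η·|x₁−x₂|_T` (sup torus distance `B5Ineq137Torus.T` in fine units); `dist({x₁,x₂},x)` = `η·min(|x₁−x|_T, |x₂−x|_T)`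
(the distance from the pair, as a set, to `x`).  (iii) The derivative = the left `ε`-difference `B1RG242Torus.deriv P 0 ε μ` in the
ROW variable, the Hölder difference taken in the same (row) variable, as printed.  (iv) PER-α CONSTANTS: `δ₁, C` depend on `α` (and
on `d, L, a, m²`), uniform in the volume `(m, K)`, the scale `k ≤ K`, `j`, `μ` and the points — the decl of record `Ineq211At`
(r15 p255002, GAPS G-B3-11: the uniform-in-α `Ineq211` is not claimed; [B4] p. 586 «the constant depends on α<1»).  (v) Mass and
`a`: FIXED `a > 0`, `m² ≥ 0`; existential constants.  (vi) ROUTE = the print's («Propositions I.2.1 and I.2.3» = [B4] Lemma 2.4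
(2.35)–(2.37) rescaled): near pairs by (2.36) on the torus (`holder236_torus`), far pairs by (2.35) and the triangle inequality
(the remark of `B4StripSumsHolder`); no Literature fact minted (`zeroTorusKernelsH` is a concrete `def`; the theorems are proved);
standard axioms.  Value = kernel certificate of a located by-reference step of B3 on the paper's own lattice `T_η` at zero
background, NOT summit progress.
Unit `lit-balaban-p03-g4` (Phase-2 proof seat p03, gen 4); HOME `run/shared/lean/pub/lit-balaban/` (row B3.Eq2.11, FILED.md, STATUS.md).
-/

namespace Literature.MathematicalPhysics.QuantumFieldTheory.Balaban1983to89.B3Ineq211ZeroTorus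

open Matrix B1RG242Torus B5Display136Torus B5Leaf237C0Torus B4Ineq115Torus B5Ineq137Torus B4Ineq116Torus B4Thm110ZeroTorus
open B3GkZeroTorusPointwise (exp_block_le)
open B4Lemma24TorusScales (holder236_torus)
open B3Sect2StatementsPart2 B3Ineq210ZeroTorus

noncomputable section

variable {P : Params}

/-! ## §1 Kernel identities and the difference of two rows of `∂^η_μ term_j` -/

section Kernel

variable (P)

/-- kernel: `ε^{−d}·(L^jε)·L^{−jd} = (L^jε)·((L^jε)^d)^{−1}`. [folklore] -/
private theorem eps_weight_one' (j : ℕ) :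
    (P.eps ^ P.d)⁻¹ * (P.spacing j * (((P.L : ℝ) ^ j) ^ P.d)⁻¹) = P.spacing j * (P.spacing j ^ P.d)⁻¹ := by
  unfold Params.spacing
  rw [mul_pow ((P.L : ℝ) ^ j) P.eps P.d, mul_inv]
  ring

/-- kernel: `(L^jη)^{1−d−α} = (L^jη)·((L^jη)^d)^{−1}·((L^jη)^α)^{−1}` (real exponent). [folklore] -/
private theorem rpow_one_sub_sub (j : ℕ) (α : ℝ) :
    P.spacing j ^ ((1 : ℝ) - (P.d : ℝ) - α) = P.spacing j * (P.spacing j ^ P.d)⁻¹ * (P.spacing j ^ α)⁻¹ := by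
  have hs := P.spacing_pos j
  rw [Real.rpow_sub hs, Real.rpow_sub hs, Real.rpow_one, Real.rpow_natCast _ P.d, div_eq_mul_inv, div_eq_mul_inv]

/-- kernel: `(L^jη)^{−1}·(η·t) = t/L^j`. [folklore] -/
private theorem scale_inv_mul (j : ℕ) (t : ℝ) : (P.spacing j)⁻¹ * (P.eps * t) = t / (P.L : ℝ) ^ j := by
  have hε : P.eps ≠ 0 := P.eps_pos.ne'
  unfold Params.spacing
  rw [mul_inv, div_eq_mul_inv]
  calc ((P.L : ℝ) ^ j)⁻¹ * P.eps⁻¹ * (P.eps * t) = t * ((P.L : ℝ) ^ j)⁻¹ * (P.eps⁻¹ * P.eps) := by ring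
    _ = t * ((P.L : ℝ) ^ j)⁻¹ := by rw [inv_mul_cancel₀ hε, mul_one]

/-- kernel: the torus distance of two distinct fine sites is at least one lattice unit (it is a natural number). [folklore] -/
private theorem one_le_T_of_ne {x x' : Site P 0} (hne : x ≠ x') : 1 ≤ T P 0 x x' := by
  have hpos : 0 < T P 0 x x' := by
    rcases (T_nonneg P 0 x x').lt_or_eq with h | h
    · exact h
    · exact absurd (eq_of_T_eq_zero (P := P) h.symm) hne
  obtain ⟨n, hn⟩ : ∃ n : ℕ, T P 0 x x' = n :=
    ⟨Finset.univ.sup (B4Sect5Torus.ccoord (Nv P 0) (toT x) (toT x')), rfl⟩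
  rw [hn] at hpos ⊢
  exact_mod_cast hpos

/-- kernel: the Hölder weight in the print's units — `(η|x₁−x₂|_T)^{−α} = ((L^jη)^α)^{−1}·(L^j/|x₁−x₂|_T)^α`. [folklore] -/
private theorem inv_rpow_dist (j : ℕ) (α : ℝ) {x₁ x₂ : Site P 0} (hT : 0 < T P 0 x₁ x₂) :
    ((P.eps * T P 0 x₁ x₂) ^ α)⁻¹ = (P.spacing j ^ α)⁻¹ * (((P.L : ℝ) ^ j / T P 0 x₁ x₂) ^ α) := by
  have hε := P.eps_pos
  have hLj : 0 < (P.L : ℝ) ^ j := pow_pos P.cast_L_pos j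
  have hw : 0 < ((P.L : ℝ) ^ j / T P 0 x₁ x₂) ^ α := Real.rpow_pos_of_pos (div_pos hLj hT) α
  have hmul : (P.eps * T P 0 x₁ x₂) ^ α * (((P.L : ℝ) ^ j / T P 0 x₁ x₂) ^ α) = P.spacing j ^ α := by
    rw [← Real.mul_rpow (mul_nonneg hε.le (T_nonneg P 0 x₁ x₂)) (div_nonneg hLj.le (T_nonneg P 0 x₁ x₂))]
    congr 1
    unfold Params.spacing
    rw [div_eq_mul_inv, show P.eps * T P 0 x₁ x₂ * ((P.L : ℝ) ^ j * (T P 0 x₁ x₂)⁻¹)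
      = (P.L : ℝ) ^ j * P.eps * (T P 0 x₁ x₂ * (T P 0 x₁ x₂)⁻¹) by ring, mul_inv_cancel₀ hT.ne', mul_one]
  rw [← hmul, mul_inv, mul_assoc, inv_mul_cancel₀ hw.ne', mul_one]

variable {P}

/-- The DIFFERENCE of two rows of the left `ε`-derivative of the `j`-th term of (2.34) (`B3Ineq210ZeroTorus.deriv_term_apply` twice):
`(∂^η_μterm_j)(x₂,x) − (∂^η_μterm_j)(x₁,x) = a_j²(L^jε)·Σ_{y,y′}[K1_j(μ;x₂,y) − K1_j(μ;x₁,y)]C^{(j)}(y,y′)(Q_jG_j^{resc})(y′,x)` — the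
quantity whose Hölder quotient (2.11) bounds, reduced to the Hölder quotient (2.36) of `K1_j`.
[cite: Balaban1983Higgs3, (2.11) p.426; Balaban1983RegularityDecay, (2.34), (2.36) p.582] -/
theorem deriv_term_sub_apply {a msq : ℝ} (ha : 0 < a) (hm : 0 ≤ msq) {j : ℕ} (hj1 : 1 ≤ j) (μ : Fin P.d)
    (x₁ x₂ x : Site P 0) :
    (deriv P 0 P.eps μ * (tower P a msq).term j) x₂ x - (deriv P 0 P.eps μ * (tower P a msq).term j) x₁ x
      = B1.aSeq a P.L j ^ 2 * P.spacing j *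
        ∑ y : Site P j, ∑ y' : Site P j,
          (K1 P a msq j μ x₂ ⟨j, y⟩ - K1 P a msq j μ x₁ ⟨j, y⟩) * Crs P a msq j y y' * (Qk P j * Grs P a msq j) y' x := by
  rw [deriv_term_apply ha hm hj1 μ x₂ x, deriv_term_apply ha hm hj1 μ x₁ x, ← mul_sub, ← Finset.sum_sub_distrib]
  congr 1
  refine Finset.sum_congr rfl fun y _ => ?_
  rw [← Finset.sum_sub_distrib]
  refine Finset.sum_congr rfl fun y' _ => ?_
  ring

end Kernel

/-! ## §2 (2.11) at one volume from the kernel inputs: far pairs and near pairs -/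

section OneVolume

variable (P)

/-- The ROW version of the three-kernel convolution `B3GkZeroTorusPointwise.term_entry_bound` (same proof, through
`B4Thm110ZeroTorus.conv_bound`): a row function `f(y)` decaying from the block of `x`, convolved with `C^{(j)}` ((2.37)) and
`(Q_jG_j^{resc})(·,x′)` ((2.35)), is `≤ C³·L^{−jd}·K_d(δ/2)²·e^{−(δ/2)|proj x − proj x′|_{T^{(j)}}}`.
[cite: Balaban1983RegularityDecay, (2.34)–(2.38) p.582; Balaban1983Higgs3, (2.11) p.426] -/
theorem row_entry_bound {a msq : ℝ} {k : ℕ} {C δ : ℝ} (hC : 0 ≤ C) (hδ : 0 < δ) (hK : KerBounds P a msq k C δ)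
    {j : ℕ} (hj1 : 1 ≤ j) (hjk : j < k) (hkm : k ≤ P.m + P.K) (x x' : Site P 0) (f : Site P j → ℝ)
    (hf : ∀ y : Site P j, |f y| ≤ C * Real.exp (-(δ * T P j (Site.proj j j x) y))) :
    |∑ y : Site P j, ∑ y' : Site P j, f y * Crs P a msq j y y' * (Qk P j * Grs P a msq j) y' x'|
      ≤ C ^ 3 * (((P.L : ℝ) ^ j) ^ P.d)⁻¹ * B4Sect5Proof.latticeConst P.d (δ / 2) ^ 2 *
          Real.exp (-(δ / 2 * T P j (Site.proj j j x) (Site.proj j j x'))) := by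
  have hj : j ≤ P.m + P.K := hjk.le.trans hkm
  have hw : 0 ≤ (((P.L : ℝ) ^ j) ^ P.d)⁻¹ := by positivity
  have h := conv_bound P hδ hC hC (mul_nonneg hw hC) (Site.proj j j x) (Site.proj j j x') f (Crs P a msq j)
    (fun y' => (Qk P j * Grs P a msq j) y' x') hf (hK.crs j hj1 hjk) (fun y' => by
      rw [QkGrs_apply P hj, abs_mul, abs_of_nonneg hw, mul_assoc]
      exact mul_le_mul_of_nonneg_left (hK.gq j hj1 hjk x' y') hw)
  calc |∑ y : Site P j, ∑ y' : Site P j, f y * Crs P a msq j y y' * (Qk P j * Grs P a msq j) y' x'|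
      ≤ C * C * ((((P.L : ℝ) ^ j) ^ P.d)⁻¹ * C) * B4Sect5Proof.latticeConst P.d (δ / 2) ^ 2 *
          Real.exp (-(δ / 2 * T P j (Site.proj j j x) (Site.proj j j x'))) := h
    _ = _ := by ring

variable {P} {a msq : ℝ}

/-- **(2.11), FAR PAIRS `|x₁ − x₂|_T ≥ L^j`, every `j`, at one volume under the kernel inputs** (the triangle inequality and the
derivative clause of (2.10), `abs_derivPieceT_le_of`; the weight `|x₁−x₂|^{−α} ≤ (L^jη)^{−α}` for `α ≥ 0`):
`η^{−d}|(∂^η_μG_{(j)})(x₂,x) − (∂^η_μG_{(j)})(x₁,x)|/(η|x₁−x₂|_T)^α ≤ 2C_der·(L^jη)((L^jη)^d)^{−1}((L^jη)^α)^{−1}·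
e^{−min(δ₀,δ/2)·min(|x₁−x|_T,|x₂−x|_T)/L^j}`. [cite: Balaban1983Higgs3, (2.10)–(2.11) p.426] -/
theorem holderFar_le_of (ha : 0 < a) (hm : 0 ≤ msq) {k : ℕ} (hkm : k ≤ P.m + P.K) {C δ C₀ δ₀ : ℝ}
    (hC : 0 ≤ C) (hδ : 0 < δ) (hC₀ : 0 ≤ C₀) (hδ₀ : 0 < δ₀) (hK : KerBounds P a msq k C δ)
    (hG0 : ∀ x x' : Site P 0, |G0unit P a msq x x'| ≤ C₀ * Real.exp (-(δ₀ * T P 0 x x')))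
    {α : ℝ} (hα0 : 0 ≤ α) (j : ℕ) (μ : Fin P.d) {x₁ x₂ : Site P 0} (hfar : (P.L : ℝ) ^ j ≤ T P 0 x₁ x₂) (x : Site P 0) :
    (P.eps ^ P.d)⁻¹ * |(deriv P 0 P.eps μ * pieceT P a msq k j) x₂ x - (deriv P 0 P.eps μ * pieceT P a msq k j) x₁ x|
        / (P.eps * T P 0 x₁ x₂) ^ α
      ≤ 2 * (2 * C₀ * Real.exp δ₀ + a ^ 2 * (C ^ 3 * B4Sect5Proof.latticeConst P.d (δ / 2) ^ 2 * Real.exp δ))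
          * (P.spacing j * (P.spacing j ^ P.d)⁻¹ * (P.spacing j ^ α)⁻¹)
          * Real.exp (-(min δ₀ (δ / 2) * (min (T P 0 x₁ x) (T P 0 x₂ x) / (P.L : ℝ) ^ j))) := by
  have hε := P.eps_pos
  have hεd : 0 < (P.eps ^ P.d)⁻¹ := by positivity
  have hs := P.spacing_pos j
  have hLj : 0 < (P.L : ℝ) ^ j := pow_pos P.cast_L_pos j
  have hm0 : 0 ≤ min δ₀ (δ / 2) := le_min hδ₀.le (by positivity)
  have h1 := abs_derivPieceT_le_of ha hm hkm hC hδ hC₀ hδ₀ hK hG0 j μ x₁ x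
  have h2 := abs_derivPieceT_le_of ha hm hkm hC hδ hC₀ hδ₀ hK hG0 j μ x₂ x
  have hCd0 : 0 ≤ 2 * C₀ * Real.exp δ₀ + a ^ 2 * (C ^ 3 * B4Sect5Proof.latticeConst P.d (δ / 2) ^ 2 * Real.exp δ) := by
    positivity
  set Cd := 2 * C₀ * Real.exp δ₀ + a ^ 2 * (C ^ 3 * B4Sect5Proof.latticeConst P.d (δ / 2) ^ 2 * Real.exp δ)
  have hw₁0 : 0 ≤ P.spacing j * (P.spacing j ^ P.d)⁻¹ := by positivity
  set w₁ := P.spacing j * (P.spacing j ^ P.d)⁻¹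
  set E := Real.exp (-(min δ₀ (δ / 2) * (min (T P 0 x₁ x) (T P 0 x₂ x) / (P.L : ℝ) ^ j)))
  have hE0 : 0 < E := Real.exp_pos _
  have e1 : Real.exp (-(min δ₀ (δ / 2) * (T P 0 x₁ x / (P.L : ℝ) ^ j))) ≤ E := by
    refine Real.exp_le_exp.2 (neg_le_neg (mul_le_mul_of_nonneg_left ?_ hm0))
    exact div_le_div_of_nonneg_right (min_le_left _ _) hLj.le
  have e2 : Real.exp (-(min δ₀ (δ / 2) * (T P 0 x₂ x / (P.L : ℝ) ^ j))) ≤ E := by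
    refine Real.exp_le_exp.2 (neg_le_neg (mul_le_mul_of_nonneg_left ?_ hm0))
    exact div_le_div_of_nonneg_right (min_le_right _ _) hLj.le
  -- numerator: the triangle inequality and the derivative clause at `x₁` and at `x₂`
  have hnum : (P.eps ^ P.d)⁻¹ *
      |(deriv P 0 P.eps μ * pieceT P a msq k j) x₂ x - (deriv P 0 P.eps μ * pieceT P a msq k j) x₁ x|
        ≤ 2 * Cd * w₁ * E := by
    calc (P.eps ^ P.d)⁻¹ *
        |(deriv P 0 P.eps μ * pieceT P a msq k j) x₂ x - (deriv P 0 P.eps μ * pieceT P a msq k j) x₁ x|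
        ≤ (P.eps ^ P.d)⁻¹ * (|(deriv P 0 P.eps μ * pieceT P a msq k j) x₂ x|
            + |(deriv P 0 P.eps μ * pieceT P a msq k j) x₁ x|) :=
          mul_le_mul_of_nonneg_left (abs_sub _ _) hεd.le
      _ = (P.eps ^ P.d)⁻¹ * |(deriv P 0 P.eps μ * pieceT P a msq k j) x₂ x|
            + (P.eps ^ P.d)⁻¹ * |(deriv P 0 P.eps μ * pieceT P a msq k j) x₁ x| := mul_add _ _ _
      _ ≤ Cd * w₁ * E + Cd * w₁ * E :=
          add_le_add (h2.trans (mul_le_mul_of_nonneg_left e2 (mul_nonneg hCd0 hw₁0)))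
            (h1.trans (mul_le_mul_of_nonneg_left e1 (mul_nonneg hCd0 hw₁0)))
      _ = 2 * Cd * w₁ * E := by ring
  -- denominator: `(η|x₁−x₂|_T)^α ≥ (L^jη)^α`
  have hsα : 0 < P.spacing j ^ α := Real.rpow_pos_of_pos hs α
  have hden : P.spacing j ^ α ≤ (P.eps * T P 0 x₁ x₂) ^ α := by
    refine Real.rpow_le_rpow hs.le ?_ hα0
    unfold Params.spacing
    rw [mul_comm]
    exact mul_le_mul_of_nonneg_left hfar hε.le
  calc (P.eps ^ P.d)⁻¹ *
        |(deriv P 0 P.eps μ * pieceT P a msq k j) x₂ x - (deriv P 0 P.eps μ * pieceT P a msq k j) x₁ x|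
          / (P.eps * T P 0 x₁ x₂) ^ α
      ≤ (2 * Cd * w₁ * E) / P.spacing j ^ α := div_le_div₀ (by positivity) hnum hsα hden
    _ = 2 * Cd * (w₁ * (P.spacing j ^ α)⁻¹) * E := by rw [div_eq_mul_inv]; ring

/-- **(2.11), NEAR PAIRS `0 < |x₁ − x₂|_T ≤ L^j`, `j ≥ 1`, at one volume under the kernel inputs** (`KerBounds`: (2.35), (2.37);
`hH`: the torus (2.36) input at level `j` in block form — `(L^j/|x₁−x₂|_T)^α|K1_j(μ;x₂,y) − K1_j(μ;x₁,y)| ≤ Ce^{−δ|proj x₁ − y|}`):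
`η^{−d}|(∂^η_μG_{(j)})(x₂,x) − (∂^η_μG_{(j)})(x₁,x)|/(η|x₁−x₂|_T)^α ≤ a²C³K_d(δ/2)²e^{δ}·(L^jη)((L^jη)^d)^{−1}((L^jη)^α)^{−1}·
e^{−(δ/2)|x₁−x|_T/L^j}` («rescaling … and application of Proposition I.2.3»: the Hölder quotient of a term of (2.34) is the
convolution of the Hölder quotient (2.36) of `K1_j` with (2.37) and (2.35)). [cite: Balaban1983Higgs3, (2.11) p.426;
Balaban1983RegularityDecay, (2.34), (2.36) p.582] -/
theorem holderNear_le_of (ha : 0 < a) (hm : 0 ≤ msq) {k : ℕ} (hkm : k ≤ P.m + P.K) {C δ : ℝ} (hC : 0 ≤ C) (hδ : 0 < δ)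
    (hK : KerBounds P a msq k C δ) {j : ℕ} (hj1 : 1 ≤ j) {α : ℝ}
    (hH : j < k → ∀ (μ : Fin P.d) (x₁ x₂ : Site P 0), x₂ ≠ x₁ → T P 0 x₁ x₂ ≤ (P.L : ℝ) ^ j → ∀ y : Site P j,
      ((P.L : ℝ) ^ j / T P 0 x₁ x₂) ^ α * |K1 P a msq j μ x₂ ⟨j, y⟩ - K1 P a msq j μ x₁ ⟨j, y⟩|
        ≤ C * Real.exp (-(δ * T P j (Site.proj j j x₁) y)))
    (μ : Fin P.d) {x₁ x₂ : Site P 0} (hne : x₁ ≠ x₂) (hnear : T P 0 x₁ x₂ ≤ (P.L : ℝ) ^ j) (x : Site P 0) :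
    (P.eps ^ P.d)⁻¹ * |(deriv P 0 P.eps μ * pieceT P a msq k j) x₂ x - (deriv P 0 P.eps μ * pieceT P a msq k j) x₁ x|
        / (P.eps * T P 0 x₁ x₂) ^ α
      ≤ a ^ 2 * (C ^ 3 * B4Sect5Proof.latticeConst P.d (δ / 2) ^ 2 * Real.exp δ)
          * (P.spacing j * (P.spacing j ^ P.d)⁻¹ * (P.spacing j ^ α)⁻¹)
          * Real.exp (-(δ / 2 * (T P 0 x₁ x / (P.L : ℝ) ^ j))) := by
  have hε := P.eps_pos
  have hεd : 0 < (P.eps ^ P.d)⁻¹ := by positivity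
  have hs := P.spacing_pos j
  have hLj : 0 < (P.L : ℝ) ^ j := pow_pos P.cast_L_pos j
  have hsα : 0 < P.spacing j ^ α := Real.rpow_pos_of_pos hs α
  rcases Nat.lt_or_ge j k with hjk | hkj
  · -- `1 ≤ j < k`: the term of (2.34)
    have hj : j ≤ P.m + P.K := hjk.le.trans hkm
    have hT1 : 1 ≤ T P 0 x₁ x₂ := one_le_T_of_ne P hne
    have hT0 : 0 < T P 0 x₁ x₂ := by linarith
    set w := ((P.L : ℝ) ^ j / T P 0 x₁ x₂) ^ α with hw
    have hw0 : 0 ≤ w := Real.rpow_nonneg (div_nonneg hLj.le hT0.le) α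
    set S := ∑ y : Site P j, ∑ y' : Site P j,
      (K1 P a msq j μ x₂ ⟨j, y⟩ - K1 P a msq j μ x₁ ⟨j, y⟩) * Crs P a msq j y y' * (Qk P j * Grs P a msq j) y' x with hS
    -- the weighted sum is the convolution of the weighted (2.36) row with (2.37) and (2.35)
    have hwS : w * |S| = |∑ y : Site P j, ∑ y' : Site P j,
        (w * (K1 P a msq j μ x₂ ⟨j, y⟩ - K1 P a msq j μ x₁ ⟨j, y⟩)) * Crs P a msq j y y' *
          (Qk P j * Grs P a msq j) y' x| := by
      calc w * |S| = |w| * |S| := by rw [abs_of_nonneg hw0]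
        _ = |w * S| := (abs_mul w S).symm
        _ = _ := by
            congr 1
            rw [hS, Finset.mul_sum]
            refine Finset.sum_congr rfl fun y _ => ?_
            rw [Finset.mul_sum]
            refine Finset.sum_congr rfl fun y' _ => ?_
            ring
    have hconv : w * |S| ≤ C ^ 3 * (((P.L : ℝ) ^ j) ^ P.d)⁻¹ * B4Sect5Proof.latticeConst P.d (δ / 2) ^ 2 *
        (Real.exp δ * Real.exp (-(δ / 2 * T P 0 x₁ x / (P.L : ℝ) ^ j))) := by
      rw [hwS]
      have hrow := row_entry_bound P hC hδ hK hj1 hjk hkm x₁ x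
        (fun y => w * (K1 P a msq j μ x₂ ⟨j, y⟩ - K1 P a msq j μ x₁ ⟨j, y⟩)) (fun y => by
          show |w * (K1 P a msq j μ x₂ ⟨j, y⟩ - K1 P a msq j μ x₁ ⟨j, y⟩)| ≤ _
          rw [abs_mul, abs_of_nonneg hw0]
          exact hH hjk μ x₁ x₂ (Ne.symm hne) hnear y)
      have hblk := exp_block_le P hj (show 0 ≤ δ / 2 by positivity) x₁ x
      rw [show 2 * (δ / 2) = δ from by ring] at hblk
      exact hrow.trans (mul_le_mul_of_nonneg_left hblk (by positivity))
    have haj : B1.aSeq a P.L j ^ 2 ≤ a ^ 2 :=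
      pow_le_pow_left₀ (B1.aSeq_pos ha (one_lt_cast_L P) hj1).le (B1.aSeq_le ha (one_lt_cast_L P) j hj1) 2
    rw [pieceT_of_pos hj1 hjk, deriv_term_sub_apply ha hm hj1 μ x₁ x₂ x, ← hS, div_eq_mul_inv,
      inv_rpow_dist P j α hT0, ← hw, abs_mul, abs_of_nonneg (by positivity)]
    calc (P.eps ^ P.d)⁻¹ * (B1.aSeq a P.L j ^ 2 * P.spacing j * |S|) * ((P.spacing j ^ α)⁻¹ * w)
        = B1.aSeq a P.L j ^ 2 * ((P.eps ^ P.d)⁻¹ * P.spacing j * (P.spacing j ^ α)⁻¹) * (w * |S|) := by ring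
      _ ≤ a ^ 2 * ((P.eps ^ P.d)⁻¹ * P.spacing j * (P.spacing j ^ α)⁻¹) *
            (C ^ 3 * (((P.L : ℝ) ^ j) ^ P.d)⁻¹ * B4Sect5Proof.latticeConst P.d (δ / 2) ^ 2 *
              (Real.exp δ * Real.exp (-(δ / 2 * T P 0 x₁ x / (P.L : ℝ) ^ j)))) := by
          refine mul_le_mul (mul_le_mul_of_nonneg_right haj (by positivity)) hconv (mul_nonneg hw0 (abs_nonneg _))
            (by positivity)
      _ = a ^ 2 * (C ^ 3 * B4Sect5Proof.latticeConst P.d (δ / 2) ^ 2 * Real.exp δ) *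
            ((P.eps ^ P.d)⁻¹ * (P.spacing j * (((P.L : ℝ) ^ j) ^ P.d)⁻¹) * (P.spacing j ^ α)⁻¹) *
            Real.exp (-(δ / 2 * T P 0 x₁ x / (P.L : ℝ) ^ j)) := by ring
      _ = _ := by rw [eps_weight_one', mul_div_assoc]
  · -- `j ≥ k`: no piece
    rw [pieceT_of_le hj1 hkj, Matrix.mul_zero]
    simp only [Matrix.zero_apply, sub_self, abs_zero, mul_zero, zero_div]
    positivity

end OneVolume

/-! ## §3 The torus (2.36) input in block form, and the kernel inputs at widened constants -/

section Inputs

variable (P) {a msq : ℝ}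

/-- kernel: for a NEAR pair (`|x₁−x₂|_T ≤ L^j`) the pair-to-point distance of (2.36) dominates the block distance:
`min(d_{XU}(x₁,(j,y)), d_{XU}(x₂,(j,y))) ≥ |proj x₁ − y|_{T^{(j)}} − 2` (`T_proj_le_dXU_add_one` and the triangle inequality).
[folklore] -/
private theorem min_dXU_ge {j : ℕ} (hj : j ≤ P.m + P.K) {x₁ x₂ : Site P 0} (hnear : T P 0 x₁ x₂ ≤ (P.L : ℝ) ^ j)
    (y : Site P j) :
    T P j (Site.proj j j x₁) y - 2 ≤ min (dXU P j x₁ ⟨j, y⟩) (dXU P j x₂ ⟨j, y⟩) := by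
  have hLj : 0 < (P.L : ℝ) ^ j := pow_pos P.cast_L_pos j
  have h1 := T_proj_le_dXU_add_one P hj x₁ y
  refine le_min (by linarith) ?_
  have hu : 0 < ((P.L : ℝ) ^ j)⁻¹ := inv_pos.2 hLj
  have huL : ((P.L : ℝ) ^ j)⁻¹ * (P.L : ℝ) ^ j = 1 := inv_mul_cancel₀ hLj.ne'
  have t := mul_le_mul_of_nonneg_left (T_triangle P 0 x₁ x₂ (fineU P ⟨j, y⟩)) hu.le
  have hn := mul_le_mul_of_nonneg_left hnear hu.le
  have e1 : dXU P j x₁ ⟨j, y⟩ = ((P.L : ℝ) ^ j)⁻¹ * T P 0 x₁ (fineU P ⟨j, y⟩) := rfl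
  have e2 : dXU P j x₂ ⟨j, y⟩ = ((P.L : ℝ) ^ j)⁻¹ * T P 0 x₂ (fineU P ⟨j, y⟩) := rfl
  rw [e1] at h1
  rw [e2]
  linarith

/-- kernel: the kernel inputs are monotone in their constants (`B5Leaf237C0Torus.decay_mono` fieldwise). [folklore] -/
private theorem kerBounds_mono {k : ℕ} {C C' δ δ' : ℝ} (hC : 0 ≤ C) (hCC : C ≤ C') (hδδ : δ' ≤ δ)
    (h : KerBounds P a msq k C δ) : KerBounds P a msq k C' δ' :=
  ⟨fun j hj1 hjk x y => decay_mono (T_nonneg P j _ _) hCC hC hδδ (h.gq j hj1 hjk x y),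
    fun j hj1 hjk y y' => decay_mono (T_nonneg P j _ _) hCC hC hδδ (h.crs j hj1 hjk y y'),
    fun j hj1 hjk μ x y => decay_mono (T_nonneg P j _ _) hCC hC hδδ (h.k1 j hj1 hjk μ x y)⟩

/-- kernel: the torus (2.36) input in the pair-to-point form of `holder236_torus` gives the block form consumed by
`holderNear_le_of`, at the widened constants `(max C (c₁e^{2δ_H}), min δ δ_H)`. [folklore] -/
private theorem near_block_form {j : ℕ} (hj : j ≤ P.m + P.K) {α c₁ δH : ℝ} (C δ : ℝ) (hc₁ : 0 ≤ c₁) (hδH : 0 < δH)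
    (hH : ∀ (μ : Fin P.d) (x x' : Site P 0), x' ≠ x → ∀ y : Site P j,
      ((P.L : ℝ) ^ j / T P 0 x x') ^ α * |K1 P a msq j μ x' ⟨j, y⟩ - K1 P a msq j μ x ⟨j, y⟩|
        ≤ c₁ * Real.exp (-(δH * min (dXU P j x ⟨j, y⟩) (dXU P j x' ⟨j, y⟩))))
    (μ : Fin P.d) (x₁ x₂ : Site P 0) (hne : x₂ ≠ x₁) (hnear : T P 0 x₁ x₂ ≤ (P.L : ℝ) ^ j) (y : Site P j) :
    ((P.L : ℝ) ^ j / T P 0 x₁ x₂) ^ α * |K1 P a msq j μ x₂ ⟨j, y⟩ - K1 P a msq j μ x₁ ⟨j, y⟩|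
      ≤ max C (c₁ * Real.exp (2 * δH)) * Real.exp (-(min δ δH * T P j (Site.proj j j x₁) y)) := by
  have h := hH μ x₁ x₂ hne y
  have hmin := min_dXU_ge P hj hnear y
  have h' : ((P.L : ℝ) ^ j / T P 0 x₁ x₂) ^ α * |K1 P a msq j μ x₂ ⟨j, y⟩ - K1 P a msq j μ x₁ ⟨j, y⟩|
      ≤ c₁ * Real.exp (2 * δH) * Real.exp (-(δH * T P j (Site.proj j j x₁) y)) := by
    refine h.trans ?_
    rw [mul_assoc, ← Real.exp_add]
    exact mul_le_mul_of_nonneg_left (Real.exp_le_exp.2 (by nlinarith [mul_le_mul_of_nonneg_left hmin hδH.le])) hc₁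
  exact decay_mono (T_nonneg P j _ _) (le_max_right _ _) (by positivity) (min_le_right _ _) h'

end Inputs

/-! ## §4 The TORUS carrier with the Hölder field and `Ineq211At` DISCHARGED, hypothesis-free and volume-uniform -/

/-- **The concrete carrier of B3 (2.10)–(2.11) for the MODEL INSTANCE `A = B̃ = 0`, `Ω = T_η`** at the scale `k` of the volume `P`:
`zeroTorusKernels P a msq k` (`B3Ineq210ZeroTorus`: sites `T^{(0)}`, `dist = η|x−x′|_T`, `absG`, `absDG`) with, in addition,
`holderDiff j μ x₁ x₂ x = η^{−d}|(∂^η_μG_{(j)})(x₂,x) − (∂^η_μG_{(j)})(x₁,x)|` (the numerator of (2.11) at `U ≡ 1`, derivative and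
difference in the row variable, `η^d`-normalised kernel) and `dist2 x₁ x₂ x = η·min(|x₁−x|_T, |x₂−x|_T) = dist({x₁,x₂},x)`; the
(2.5)/(2.12) fields stay unmodelled (`0`). [cite: Balaban1983Higgs3, (2.10)–(2.11) p.426] -/
def zeroTorusKernelsH (P : Params) (a msq : ℝ) (k : ℕ) : ScaledKernels :=
  { zeroTorusKernels P a msq k with
    dist2 := fun x₁ x₂ x => P.eps * min (T P 0 x₁ x) (T P 0 x₂ x)
    holderDiff := fun j μ x₁ x₂ x => (P.eps ^ P.d)⁻¹ *
      |(deriv P 0 P.eps μ * pieceT P a msq k j) x₂ x - (deriv P 0 P.eps μ * pieceT P a msq k j) x₁ x| }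

section Carrier

variable {a msq : ℝ} {k : ℕ}

/-- the carrier's `L^jη` is the tower's spacing `L^jε`. [cite: Balaban1983Higgs3, (2.11) p.426] -/
theorem scaleH_eq (j : ℕ) : (zeroTorusKernelsH P a msq k).scale j = P.spacing j := rfl

/-- (2.10) for the Hölder carrier IS (2.10) for `zeroTorusKernels` (same sites, distance, scales and kernels).
[cite: Balaban1983Higgs3, (2.10) p.426] -/
theorem ineq210_iff_H (δ₁ C : ℝ) :
    (zeroTorusKernelsH P a msq k).Ineq210 δ₁ C ↔ (zeroTorusKernels P a msq k).Ineq210 δ₁ C := Iff.rfl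

end Carrier

/-- **B3 (2.11) p. 426 [PDF 16] PROVED FOR THE TORUS MODEL INSTANCE `A = B̃ = 0`, `Ω = T_η`, AT EVERY FIXED HÖLDER EXPONENT,
hypothesis-free and uniform in the volume and the scale**: for `d ≥ 1`, odd `L > 1`, `a > 0`, `m² ≥ 0` and `0 ≤ α < 1` there are
`δ₁ > 0`, `C > 0` (functions of `d, L, a, m², α`) such that for EVERY volume `P = (d, L, m, K)` of Bałaban's scalar torus tower
and every scale `1 ≤ k ≤ K`: `(zeroTorusKernelsH P a msq k).Ineq211At α δ₁ C`, i.e. for all `j`, `μ`, `x₁ ≠ x₂`, `x`: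
`η^{−d}|(D^η_μG^η_{(j)})(x₂,x) − (D^η_μG^η_{(j)})(x₁,x)|/|x₁−x₂|^α ≤ C(L^jη)^{1−d−α}e^{−δ₁(L^jη)^{−1}dist({x₁,x₂},x)}`.
Print: *"This applies also to Hölder norms, e.g. we have (2.11), 0 ≤ α < 1 … obtained by rescaling from the η-lattice to the
L^{−j}-lattice and application of Propositions I.2.1 and I.2.3."*  Route: exactly that — near pairs `|x₁−x₂|_T ≤ L^j` by [B4]
Lemma 2.4 (2.36) on the torus (`B4Lemma24TorusScales.holder236_torus`, rate before `α`, constant after) convolved with (2.37),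
(2.35) (`holderNear_le_of`); far pairs by the derivative clause of (2.10) and the triangle inequality (`holderFar_le_of`); the
`j = 0` piece `C^{(0),η}` is always «far» (`|x₁−x₂|_T ≥ 1 = L^0`).  Per-α constants as in the decl of record `Ineq211At`.
[cite: Balaban1983Higgs3, (2.11) p.426] -/
theorem ineq211At_zeroTorusH (d L : ℕ) (hd : 1 ≤ d) (hL : Odd L ∧ 1 < L) {a : ℝ} (ha : 0 < a) {msq : ℝ}
    (hmsq : 0 ≤ msq) {α : ℝ} (hα0 : 0 ≤ α) (hα1 : α < 1) :
    ∃ δ₁ C : ℝ, 0 < δ₁ ∧ 0 < C ∧ ∀ (P : Params), P.d = d → P.L = L →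
      ∀ k : ℕ, 1 ≤ k → k ≤ P.K → (zeroTorusKernelsH P a msq k).Ineq211At α δ₁ C := by
  obtain ⟨C, δ, hC, hδ, hK⟩ := kerBounds_torus d L hd hL ha msq
  obtain ⟨δH, hδH, hHall⟩ := holder236_torus d L hd hL ha msq
  obtain ⟨c₁, hc₁, hH⟩ := hHall hα0 hα1
  -- the `j = 0` constants depend on `d, L, a, m²` only; read them off any volume with these `d, L`
  obtain ⟨P₀, hP₀d, hP₀L⟩ : ∃ P₀ : Params, P₀.d = d ∧ P₀.L = L := ⟨⟨d, L, 0, 0, hd, hL⟩, rfl, rfl⟩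
  set C₀ := 2 / gamma0 L a with hC₀def
  set δ₀ := dK0 d L a msq with hδ₀def
  have hC₀ : 0 ≤ C₀ := by
    rw [hC₀def, ← hP₀L]; exact (div_pos two_pos (gamma0_pos (P := P₀) ha)).le
  have hδ₀ : 0 < δ₀ := by rw [hδ₀def, ← hP₀d, ← hP₀L]; exact dK0_pos (P := P₀) ha hmsq
  -- widened common constants for (2.35)/(2.37) and the block form of (2.36)
  set C' := max C (c₁ * Real.exp (2 * δH))
  set δ' := min δ δH
  have hC' : 0 ≤ C' := hC.trans (le_max_left _ _)
  have hδ' : 0 < δ' := lt_min hδ hδH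
  have hCn0 : 0 ≤ a ^ 2 * (C' ^ 3 * B4Sect5Proof.latticeConst d (δ' / 2) ^ 2 * Real.exp δ') := by positivity
  have hCd0 : 0 ≤ 2 * C₀ * Real.exp δ₀ + a ^ 2 * (C' ^ 3 * B4Sect5Proof.latticeConst d (δ' / 2) ^ 2 * Real.exp δ') := by
    positivity
  set Cd := 2 * C₀ * Real.exp δ₀ + a ^ 2 * (C' ^ 3 * B4Sect5Proof.latticeConst d (δ' / 2) ^ 2 * Real.exp δ') with hCd
  set Cn := a ^ 2 * (C' ^ 3 * B4Sect5Proof.latticeConst d (δ' / 2) ^ 2 * Real.exp δ') with hCn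
  refine ⟨min δ₀ (δ' / 2), 2 * Cd + Cn + 1, lt_min hδ₀ (by positivity), by positivity, ?_⟩
  intro P hPd hPL k hk1 hkK
  have hkm : k ≤ P.m + P.K := hkK.trans (Nat.le_add_left _ _)
  have hcapk : ∀ j, j ≤ P.K → P.spacing j ^ 2 * msq ≤ msq := by
    intro j hjK
    have hs1 : P.spacing j ≤ 1 := by rw [← P.spacing_K]; exact spacing_le_spacing P hjK
    have hs0 := (P.spacing_pos j).le
    calc P.spacing j ^ 2 * msq ≤ 1 * msq := mul_le_mul_of_nonneg_right (pow_le_one₀ hs0 hs1) hmsq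
      _ = msq := one_mul _
  have hKB : KerBounds P a msq k C' δ' :=
    kerBounds_mono P hC (le_max_left _ _) (min_le_left _ _) (hK P hPd hPL msq hmsq k hkm (hcapk k hkK))
  have hHB : ∀ j, 1 ≤ j → j < k → ∀ (μ : Fin P.d) (x₁ x₂ : Site P 0), x₂ ≠ x₁ → T P 0 x₁ x₂ ≤ (P.L : ℝ) ^ j →
      ∀ y : Site P j, ((P.L : ℝ) ^ j / T P 0 x₁ x₂) ^ α * |K1 P a msq j μ x₂ ⟨j, y⟩ - K1 P a msq j μ x₁ ⟨j, y⟩|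
        ≤ C' * Real.exp (-(δ' * T P j (Site.proj j j x₁) y)) := by
    intro j hj1 hjk μ x₁ x₂ hne hnear y
    have hjm : j ≤ P.m + P.K := hjk.le.trans hkm
    exact near_block_form P hjm C δ hc₁.le hδH (fun μ x x' hne' y' => hH P hPd hPL msq hmsq j hj1 hjm
      (hcapk j (hjk.le.trans hkK)) μ x x' hne' y') μ x₁ x₂ hne hnear y
  subst hPd hPL
  have hG0 : ∀ x x' : Site P 0, |G0unit P a msq x x'| ≤ C₀ * Real.exp (-(δ₀ * T P 0 x x')) :=
    fun x x' => G0unit_decay (P := P) ha hmsq x x'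
  intro j μ x₁ x₂ x hne
  have hs := P.spacing_pos j
  have hLj : 0 < (P.L : ℝ) ^ j := pow_pos P.cast_L_pos j
  have hW : 0 ≤ P.spacing j * (P.spacing j ^ P.d)⁻¹ * (P.spacing j ^ α)⁻¹ := by
    have := Real.rpow_pos_of_pos hs α; positivity
  have hT1 : 1 ≤ T P 0 x₁ x₂ := one_le_T_of_ne P hne
  show (P.eps ^ P.d)⁻¹ *
      |(deriv P 0 P.eps μ * pieceT P a msq k j) x₂ x - (deriv P 0 P.eps μ * pieceT P a msq k j) x₁ x|
        / (P.eps * T P 0 x₁ x₂) ^ α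
    ≤ (2 * Cd + Cn + 1) * P.spacing j ^ ((1 : ℝ) - (P.d : ℝ) - α)
        * Real.exp (-(min δ₀ (δ' / 2) * (P.spacing j)⁻¹ * (P.eps * min (T P 0 x₁ x) (T P 0 x₂ x))))
  rw [rpow_one_sub_sub, mul_assoc (min δ₀ (δ' / 2)) ((P.spacing j)⁻¹), scale_inv_mul]
  rcases le_or_gt ((P.L : ℝ) ^ j) (T P 0 x₁ x₂) with hfar | hlt
  · -- far pairs (every `j`; the `j = 0` piece always lands here)
    refine (holderFar_le_of ha hmsq hkm hC' hδ' hC₀ hδ₀ hKB hG0 hα0 j μ hfar x).trans ?_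
    refine mul_le_mul_of_nonneg_right (mul_le_mul_of_nonneg_right (by linarith) hW) (Real.exp_pos _).le
  · -- near pairs: `|x₁−x₂|_T < L^j` forces `j ≥ 1`
    have hj1 : 1 ≤ j := by
      rcases Nat.eq_zero_or_pos j with h0 | hpos
      · subst h0; simp only [pow_zero] at hlt; linarith
      · exact hpos
    have hE : Real.exp (-(δ' / 2 * (T P 0 x₁ x / (P.L : ℝ) ^ j)))
        ≤ Real.exp (-(min δ₀ (δ' / 2) * (min (T P 0 x₁ x) (T P 0 x₂ x) / (P.L : ℝ) ^ j))) := by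
      refine Real.exp_le_exp.2 (neg_le_neg ?_)
      have hq : 0 ≤ min (T P 0 x₁ x) (T P 0 x₂ x) / (P.L : ℝ) ^ j :=
        div_nonneg (le_min (T_nonneg P 0 _ _) (T_nonneg P 0 _ _)) hLj.le
      have hq' : min (T P 0 x₁ x) (T P 0 x₂ x) / (P.L : ℝ) ^ j ≤ T P 0 x₁ x / (P.L : ℝ) ^ j :=
        div_le_div_of_nonneg_right (min_le_left _ _) hLj.le
      calc min δ₀ (δ' / 2) * (min (T P 0 x₁ x) (T P 0 x₂ x) / (P.L : ℝ) ^ j)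
          ≤ δ' / 2 * (min (T P 0 x₁ x) (T P 0 x₂ x) / (P.L : ℝ) ^ j) :=
            mul_le_mul_of_nonneg_right (min_le_right _ _) hq
        _ ≤ δ' / 2 * (T P 0 x₁ x / (P.L : ℝ) ^ j) := mul_le_mul_of_nonneg_left hq' (by positivity)
    refine (holderNear_le_of ha hmsq hkm hC' hδ' hKB hj1 (fun hjk => hHB j hj1 hjk) μ hne hlt.le x).trans ?_
    calc Cn * (P.spacing j * (P.spacing j ^ P.d)⁻¹ * (P.spacing j ^ α)⁻¹) *
          Real.exp (-(δ' / 2 * (T P 0 x₁ x / (P.L : ℝ) ^ j)))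
        ≤ Cn * (P.spacing j * (P.spacing j ^ P.d)⁻¹ * (P.spacing j ^ α)⁻¹) *
          Real.exp (-(min δ₀ (δ' / 2) * (min (T P 0 x₁ x) (T P 0 x₂ x) / (P.L : ℝ) ^ j))) :=
          mul_le_mul_of_nonneg_left hE (mul_nonneg hCn0 hW)
      _ ≤ _ := by
          refine mul_le_mul_of_nonneg_right (mul_le_mul_of_nonneg_right (by linarith) hW) (Real.exp_pos _).le

/-- **(2.10) AND (2.11) TOGETHER on the Hölder torus carrier** (per-α constants; (2.10) from `B3Ineq210ZeroTorus.ineq210_zeroTorus`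
through `ineq210_iff_H`). [cite: Balaban1983Higgs3, (2.10)–(2.11) p.426] -/
theorem ineq210_and_211At_zeroTorusH (d L : ℕ) (hd : 1 ≤ d) (hL : Odd L ∧ 1 < L) {a : ℝ} (ha : 0 < a) {msq : ℝ}
    (hmsq : 0 ≤ msq) {α : ℝ} (hα0 : 0 ≤ α) (hα1 : α < 1) :
    ∃ δ₁ C : ℝ, 0 < δ₁ ∧ 0 < C ∧ ∀ (P : Params), P.d = d → P.L = L →
      ∀ k : ℕ, 1 ≤ k → k ≤ P.K →
        (zeroTorusKernelsH P a msq k).Ineq210 δ₁ C ∧ (zeroTorusKernelsH P a msq k).Ineq211At α δ₁ C := by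
  obtain ⟨δa, Ca, hδa, hCa, ha'⟩ := ineq210_zeroTorus d L hd hL ha hmsq
  obtain ⟨δb, Cb, hδb, hCb, hb'⟩ := ineq211At_zeroTorusH d L hd hL ha hmsq hα0 hα1
  refine ⟨min δa δb, max Ca Cb, lt_min hδa hδb, lt_max_of_lt_left hCa, fun P hPd hPL k hk1 hkK => ⟨?_, ?_⟩⟩
  · have h := ha' P hPd hPL k hk1 hkK
    rw [ineq210_iff_H]
    intro j x x'
    obtain ⟨h1, h2⟩ := h j x x'
    have hsc : 0 < (zeroTorusKernels P a msq k).scale j := P.spacing_pos j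
    have hdist : 0 ≤ (zeroTorusKernels P a msq k).dist x x' := mul_nonneg P.eps_pos.le (T_nonneg P 0 x x')
    refine ⟨h1.trans ?_, fun μ => (h2 μ).trans ?_⟩
    · refine mul_le_mul (mul_le_mul_of_nonneg_right (le_max_left _ _) (Real.rpow_nonneg hsc.le _))
        (Real.exp_le_exp.2 (neg_le_neg ?_)) (Real.exp_pos _).le (by positivity)
      rw [mul_assoc, mul_assoc]
      exact mul_le_mul_of_nonneg_right (min_le_left _ _) (mul_nonneg (inv_pos.2 hsc).le hdist)
    · refine mul_le_mul (mul_le_mul_of_nonneg_right (le_max_left _ _) (Real.rpow_nonneg hsc.le _))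
        (Real.exp_le_exp.2 (neg_le_neg ?_)) (Real.exp_pos _).le (by positivity)
      rw [mul_assoc, mul_assoc]
      exact mul_le_mul_of_nonneg_right (min_le_left _ _) (mul_nonneg (inv_pos.2 hsc).le hdist)
  · have h := hb' P hPd hPL k hk1 hkK
    intro j μ x₁ x₂ x hne
    have hsc : 0 < (zeroTorusKernelsH P a msq k).scale j := P.spacing_pos j
    have hdist : 0 ≤ (zeroTorusKernelsH P a msq k).dist2 x₁ x₂ x :=
      mul_nonneg P.eps_pos.le (le_min (T_nonneg P 0 _ _) (T_nonneg P 0 _ _))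
    refine (h j μ x₁ x₂ x hne).trans ?_
    refine mul_le_mul (mul_le_mul_of_nonneg_right (le_max_right _ _) (Real.rpow_nonneg hsc.le _))
      (Real.exp_le_exp.2 (neg_le_neg ?_)) (Real.exp_pos _).le (by positivity)
    rw [mul_assoc, mul_assoc]
    exact mul_le_mul_of_nonneg_right (min_le_right _ _) (mul_nonneg (inv_pos.2 hsc).le hdist)

/-! ## §5 Non-vacuity: the binders are inhabited (`d = 3`, `L = 3`, `a = 1`, `m² = 0`, `α = 1/2`; the volume `m = K = 1`, `k = 1`) -/

/-- The constants exist and (2.11) holds at `α = 1/2` for an explicit torus volume. [cite: Balaban1983Higgs3, (2.11) p.426] -/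
theorem ineq211At_zeroTorusH_witness :
    ∃ δ₁ C : ℝ, 0 < δ₁ ∧ 0 < C ∧
      (zeroTorusKernelsH (⟨3, 3, 1, 1, by norm_num, ⟨⟨1, by norm_num⟩, by norm_num⟩⟩ : Params) 1 0 1).Ineq211At
        (1 / 2) δ₁ C := by
  obtain ⟨δ₁, C, hδ₁, hC, h⟩ := ineq211At_zeroTorusH 3 3 (by norm_num) ⟨⟨1, by norm_num⟩, by norm_num⟩ (a := 1) one_pos
    (msq := 0) le_rfl (α := 1 / 2) (by norm_num) (by norm_num)
  exact ⟨δ₁, C, hδ₁, hC, h _ rfl rfl 1 le_rfl le_rfl⟩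

end

end Literature.MathematicalPhysics.QuantumFieldTheory.Balaban1983to89.B3Ineq211ZeroTorus
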